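import Summits.CriticalPhenomena.PercolationContinuityZ3.Theorems.PercNearOneGluingNoHeavyLowerTailDCInductionShell
import HarnessLib

/-!
# `NoHeavyLowerTail` (stmt-CriticalPhenomena-4575) — the SHARP single-edge law of the (DC) induction: the weakest one-step statement that
# makes deletion–contraction of one star pair close the outsider step

Support file (prover `prim-hp-3`, hull-port line; `--supports stmt-CriticalPhenomena-4575`).  No definitions, no named facts, no sorries.

Setting and notation as in `…DCInductionShell.lean` (two pendant stars `o₁, o₂ ∉ A`, `w s(o₁,o₂) = 0`, all star pairs to relays; E-mass `E_w(v)`,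
lightness `I_w`, ports = relays with a star pair of nonzero weight, `M_w = max_{ports} I_w`).

For a relay `v` outside the ports and a fractional star pair `e = s(a,o)` (`w₀ = w[e↦0]`, `w₁ = w[e↦1]`, `c = w e`), affinity gives
`E_w(v) = (1−c) E_{w₀}(v) + c E_{w₁}(v)` (`HullPort.real_update_affine`), and the induction hypothesis ((DC) one fractional pair down) gives
`E_{w₀}(v) ≤ M_{w₀}` and NOTHING ELSE about `w₀`.  Hence the induction closes at `w` through the pair `e` iff
   SHARP(e):  `(1 − c)·M_{w₀} + c·E_{w₁}(v) ≤ M_w`,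
the weakest single-edge law (the common-witness law COND-OUT+ of `…DCInductionShell.lean` implies it: `(1−c)I_{w₀}(t) + cI_{w₁}(t) = I_w(t) ≤ M_w`).
* `HullPort.outsiderStep_of_sharp` : SHARP (for all instances, with `M_{w₀}` replaced by any upper bound `m ≥ 0` of the port lightnesses of `w₀`)
  → the OUTSIDER STEP of `dc_of_outsiderStep`.
* `HullPort.dc_of_sharp` : SHARP → (DC).
Census (seat, exact, lab-gen6 sharp.py): SHARP and COND-OUT+ have 0 failures on the families where the qualitative laws GOOD-EDGE / CHAIN-AB and the
strict COND-OUT fail (memo `run/shared/lean/prim/prim-hp-3/HULLPORT-REF-gen6.md` §8–§12).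
-/

noncomputable section

namespace Summit.CriticalPhenomena.PercolationContinuityZ3.Theorems

open MeasureTheory Set Literature.Probability.LatticeModels Literature.Probability.Percolation
open scoped Classical BigOperators

variable {n : ℕ}

namespace HullPort

/-- **The OUTSIDER STEP from the SHARP single-edge law.**  If for every two-pendant-stars weight function `w` with a fractional star pair and every
relay `v` outside its ports there are a fractional star pair `e = s(a,o)`, a port `p` of `w` and a number `m ≥ 0` bounding the lightness of
every port of `w[e↦0]`, with `(1 − w e)·m + (w e)·E_{w[e↦1]}(v) ≤ I_w(p)`, then the outsider step holds ((DC) one pair down bounds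
`E_{w[e↦0]}(v)` by `m`; affinity in the coordinate `e`). [this work] -/
theorem outsiderStep_of_sharp (A : Finset (Fin n)) (o₁ o₂ : Fin n) (j : ℕ)
    (hSharp : (∀ w : Sym2 (Fin n) → unitInterval, w s(o₁, o₂) = 0 → (∀ u, w s(o₁, u) ≠ 0 → u ∈ A) → (∀ u, w s(o₂, u) ≠ 0 → u ∈ A) →
      ∀ v ∈ A, w s(o₁, v) = 0 → w s(o₂, v) = 0 →
      (∃ a ∈ A, (w s(o₁, a) ≠ 0 ∧ w s(o₁, a) ≠ 1) ∨ (w s(o₂, a) ≠ 0 ∧ w s(o₂, a) ≠ 1)) →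
      ∃ o ∈ ({o₁, o₂} : Finset (Fin n)), ∃ a ∈ A, w s(o, a) ≠ 0 ∧ w s(o, a) ≠ 1 ∧ ∃ p ∈ A, (w s(o₁, p) ≠ 0 ∨ w s(o₂, p) ≠ 0) ∧
        ∃ m : ℝ, 0 ≤ m ∧
        (∀ p' ∈ A, ((Function.update w s(a, o) 0) s(o₁, p') ≠ 0 ∨ (Function.update w s(a, o) 0) s(o₂, p') ≠ 0) →
          (prodBernoulli (Function.update w s(a, o) 0)).real {ω : BondConfig (Fin n) | (A.filter fun z => ω ∈ openConn p' z).card ≤ j} ≤ m) ∧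
        (1 - (w s(a, o) : ℝ)) * m + (w s(a, o) : ℝ) *
          ((prodBernoulli (Function.update w s(a, o) 1)).real {ω : BondConfig (Fin n) | (∀ x ∈ ({o₁, o₂} : Finset (Fin n)), ω ∉ openConn v x) ∧
              1 ≤ (A.filter fun z => ∃ x ∈ ({o₁, o₂} : Finset (Fin n)), ω ∈ openConn x z).card ∧
              (A.filter fun z => ∃ x ∈ ({o₁, o₂} : Finset (Fin n)), ω ∈ openConn x z).card ≤ j} +
            (prodBernoulli (Function.update w s(a, o) 1)).real {ω : BondConfig (Fin n) | (∃ x ∈ ({o₁, o₂} : Finset (Fin n)), ω ∈ openConn v x) ∧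
              (A.filter fun z => ω ∈ openConn v z).card ≤ j}) ≤
        (prodBernoulli w).real {ω : BondConfig (Fin n) | (A.filter fun z => ω ∈ openConn p z).card ≤ j})) :
    (∀ w : Sym2 (Fin n) → unitInterval,
      o₁ ∉ A → o₂ ∉ A → o₁ ≠ o₂ → w s(o₁, o₂) = 0 → (∀ u, w s(o₁, u) ≠ 0 → u ∈ A) → (∀ u, w s(o₂, u) ≠ 0 → u ∈ A) →
      (∀ w' : Sym2 (Fin n) → unitInterval, w' s(o₁, o₂) = 0 → (∀ u, w' s(o₁, u) ≠ 0 → u ∈ A) → (∀ u, w' s(o₂, u) ≠ 0 → u ∈ A) →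
        ((A.filter fun x => w' s(o₁, x) ≠ 0 ∧ w' s(o₁, x) ≠ 1).card + (A.filter fun x => w' s(o₂, x) ≠ 0 ∧ w' s(o₂, x) ≠ 1).card) <
          ((A.filter fun x => w s(o₁, x) ≠ 0 ∧ w s(o₁, x) ≠ 1).card + (A.filter fun x => w s(o₂, x) ≠ 0 ∧ w s(o₂, x) ≠ 1).card) →
        (∀ v ∈ A, ∃ p ∈ A, (((prodBernoulli w').real {ω : BondConfig (Fin n) | (∀ x ∈ ({o₁, o₂} : Finset (Fin n)), ω ∉ openConn v x) ∧
              1 ≤ (A.filter fun z => ∃ x ∈ ({o₁, o₂} : Finset (Fin n)), ω ∈ openConn x z).card ∧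
              (A.filter fun z => ∃ x ∈ ({o₁, o₂} : Finset (Fin n)), ω ∈ openConn x z).card ≤ j} +
            (prodBernoulli w').real {ω : BondConfig (Fin n) | (∃ x ∈ ({o₁, o₂} : Finset (Fin n)), ω ∈ openConn v x) ∧
              (A.filter fun z => ω ∈ openConn v z).card ≤ j}) = 0 ∨ w' s(o₁, p) ≠ 0 ∨ w' s(o₂, p) ≠ 0) ∧
          ((prodBernoulli w').real {ω : BondConfig (Fin n) | (∀ x ∈ ({o₁, o₂} : Finset (Fin n)), ω ∉ openConn v x) ∧
              1 ≤ (A.filter fun z => ∃ x ∈ ({o₁, o₂} : Finset (Fin n)), ω ∈ openConn x z).card ∧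
              (A.filter fun z => ∃ x ∈ ({o₁, o₂} : Finset (Fin n)), ω ∈ openConn x z).card ≤ j} +
            (prodBernoulli w').real {ω : BondConfig (Fin n) | (∃ x ∈ ({o₁, o₂} : Finset (Fin n)), ω ∈ openConn v x) ∧
              (A.filter fun z => ω ∈ openConn v z).card ≤ j}) ≤
          (prodBernoulli w').real {ω : BondConfig (Fin n) | (A.filter fun z => ω ∈ openConn p z).card ≤ j})) →
      ∀ v ∈ A, w s(o₁, v) = 0 → w s(o₂, v) = 0 →
      (∃ a ∈ A, (w s(o₁, a) ≠ 0 ∧ w s(o₁, a) ≠ 1) ∨ (w s(o₂, a) ≠ 0 ∧ w s(o₂, a) ≠ 1)) →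
      ∃ p ∈ A, (((prodBernoulli w).real {ω : BondConfig (Fin n) | (∀ x ∈ ({o₁, o₂} : Finset (Fin n)), ω ∉ openConn v x) ∧
              1 ≤ (A.filter fun z => ∃ x ∈ ({o₁, o₂} : Finset (Fin n)), ω ∈ openConn x z).card ∧
              (A.filter fun z => ∃ x ∈ ({o₁, o₂} : Finset (Fin n)), ω ∈ openConn x z).card ≤ j} +
            (prodBernoulli w).real {ω : BondConfig (Fin n) | (∃ x ∈ ({o₁, o₂} : Finset (Fin n)), ω ∈ openConn v x) ∧
              (A.filter fun z => ω ∈ openConn v z).card ≤ j}) = 0 ∨ w s(o₁, p) ≠ 0 ∨ w s(o₂, p) ≠ 0) ∧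
        ((prodBernoulli w).real {ω : BondConfig (Fin n) | (∀ x ∈ ({o₁, o₂} : Finset (Fin n)), ω ∉ openConn v x) ∧
              1 ≤ (A.filter fun z => ∃ x ∈ ({o₁, o₂} : Finset (Fin n)), ω ∈ openConn x z).card ∧
              (A.filter fun z => ∃ x ∈ ({o₁, o₂} : Finset (Fin n)), ω ∈ openConn x z).card ≤ j} +
            (prodBernoulli w).real {ω : BondConfig (Fin n) | (∃ x ∈ ({o₁, o₂} : Finset (Fin n)), ω ∈ openConn v x) ∧
              (A.filter fun z => ω ∈ openConn v z).card ≤ j}) ≤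
        (prodBernoulli w).real {ω : BondConfig (Fin n) | (A.filter fun z => ω ∈ openConn p z).card ≤ j}) := by
  intro w ho₁A ho₂A h12 hw12 hpend₁ hpend₂ IH v hvA hv₁ hv₂ hex
  obtain ⟨o, ho, a, haA, hne0, hne1, p, hpA, hpport, m, hm0, hmax, hle⟩ := hSharp w hw12 hpend₁ hpend₂ v hvA hv₁ hv₂ hex
  obtain ⟨h012, hp₁', hp₂', -, hNlt⟩ := twoStars_erase w A o₁ o₂ o a ho₁A ho₂A ho haA hw12 hpend₁ hpend₂ hne0 hne1
  obtain ⟨p₀, hp₀A, hp₀_or, hp₀_le⟩ := IH (Function.update w s(a, o) 0) h012 hp₁' hp₂' hNlt v hvA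
  -- `E_{w₀}(v) ≤ m`
  have h0 : ((prodBernoulli (Function.update w s(a, o) 0)).real {ω : BondConfig (Fin n) | (∀ x ∈ ({o₁, o₂} : Finset (Fin n)), ω ∉ openConn v x) ∧
              1 ≤ (A.filter fun z => ∃ x ∈ ({o₁, o₂} : Finset (Fin n)), ω ∈ openConn x z).card ∧
              (A.filter fun z => ∃ x ∈ ({o₁, o₂} : Finset (Fin n)), ω ∈ openConn x z).card ≤ j} +
            (prodBernoulli (Function.update w s(a, o) 0)).real {ω : BondConfig (Fin n) | (∃ x ∈ ({o₁, o₂} : Finset (Fin n)), ω ∈ openConn v x) ∧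
              (A.filter fun z => ω ∈ openConn v z).card ≤ j}) ≤ m := by
    rcases hp₀_or with h0 | h | h
    · rw [h0]; exact hm0
    · exact hp₀_le.trans (hmax p₀ hp₀A (Or.inl h))
    · exact hp₀_le.trans (hmax p₀ hp₀A (Or.inr h))
  -- affinity of the two E-events in the coordinate `s(a,o)`
  set e : Sym2 (Fin n) := s(a, o) with he
  set Sb : Set (BondConfig (Fin n)) := {ω | (∀ x ∈ ({o₁, o₂} : Finset (Fin n)), ω ∉ openConn v x) ∧
        1 ≤ (A.filter fun z => ∃ x ∈ ({o₁, o₂} : Finset (Fin n)), ω ∈ openConn x z).card ∧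
        (A.filter fun z => ∃ x ∈ ({o₁, o₂} : Finset (Fin n)), ω ∈ openConn x z).card ≤ j} with hSb
  set Sa : Set (BondConfig (Fin n)) := {ω | (∃ x ∈ ({o₁, o₂} : Finset (Fin n)), ω ∈ openConn v x) ∧
        (A.filter fun z => ω ∈ openConn v z).card ≤ j} with hSa
  have hwe : Function.update w e (w e) = w := Function.update_eq_self e w
  have aff : ∀ S : Set (BondConfig (Fin n)),
      (prodBernoulli w).real S = (1 - (w e : ℝ)) * (prodBernoulli (Function.update w e 0)).real S +
        (w e : ℝ) * (prodBernoulli (Function.update w e 1)).real S := by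
    intro S
    have h := real_update_affine w e (w e) S
    rw [hwe] at h
    exact h
  have hc0 : 0 ≤ (w e : ℝ) := (w e).2.1
  have hc1 : (w e : ℝ) ≤ 1 := (w e).2.2
  refine ⟨p, hpA, Or.inr hpport, ?_⟩
  rw [aff Sb, aff Sa]
  have hA : (1 - (w e : ℝ)) * ((prodBernoulli (Function.update w e 0)).real Sb + (prodBernoulli (Function.update w e 0)).real Sa) ≤
      (1 - (w e : ℝ)) * m := mul_le_mul_of_nonneg_left h0 (by linarith)
  nlinarith [hA, hle, hc0]

/-- **(DC) from the SHARP single-edge law.** [this work] -/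
theorem dc_of_sharp (A : Finset (Fin n)) (o₁ o₂ : Fin n) (j : ℕ)
    (hSharp : (∀ w : Sym2 (Fin n) → unitInterval, w s(o₁, o₂) = 0 → (∀ u, w s(o₁, u) ≠ 0 → u ∈ A) → (∀ u, w s(o₂, u) ≠ 0 → u ∈ A) →
      ∀ v ∈ A, w s(o₁, v) = 0 → w s(o₂, v) = 0 →
      (∃ a ∈ A, (w s(o₁, a) ≠ 0 ∧ w s(o₁, a) ≠ 1) ∨ (w s(o₂, a) ≠ 0 ∧ w s(o₂, a) ≠ 1)) →
      ∃ o ∈ ({o₁, o₂} : Finset (Fin n)), ∃ a ∈ A, w s(o, a) ≠ 0 ∧ w s(o, a) ≠ 1 ∧ ∃ p ∈ A, (w s(o₁, p) ≠ 0 ∨ w s(o₂, p) ≠ 0) ∧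
        ∃ m : ℝ, 0 ≤ m ∧
        (∀ p' ∈ A, ((Function.update w s(a, o) 0) s(o₁, p') ≠ 0 ∨ (Function.update w s(a, o) 0) s(o₂, p') ≠ 0) →
          (prodBernoulli (Function.update w s(a, o) 0)).real {ω : BondConfig (Fin n) | (A.filter fun z => ω ∈ openConn p' z).card ≤ j} ≤ m) ∧
        (1 - (w s(a, o) : ℝ)) * m + (w s(a, o) : ℝ) *
          ((prodBernoulli (Function.update w s(a, o) 1)).real {ω : BondConfig (Fin n) | (∀ x ∈ ({o₁, o₂} : Finset (Fin n)), ω ∉ openConn v x) ∧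
              1 ≤ (A.filter fun z => ∃ x ∈ ({o₁, o₂} : Finset (Fin n)), ω ∈ openConn x z).card ∧
              (A.filter fun z => ∃ x ∈ ({o₁, o₂} : Finset (Fin n)), ω ∈ openConn x z).card ≤ j} +
            (prodBernoulli (Function.update w s(a, o) 1)).real {ω : BondConfig (Fin n) | (∃ x ∈ ({o₁, o₂} : Finset (Fin n)), ω ∈ openConn v x) ∧
              (A.filter fun z => ω ∈ openConn v z).card ≤ j}) ≤
        (prodBernoulli w).real {ω : BondConfig (Fin n) | (A.filter fun z => ω ∈ openConn p z).card ≤ j}))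
    (w : Sym2 (Fin n) → unitInterval)
    (ho₁A : o₁ ∉ A) (ho₂A : o₂ ∉ A) (h12 : o₁ ≠ o₂) (hw12 : w s(o₁, o₂) = 0)
    (hpend₁ : ∀ u, w s(o₁, u) ≠ 0 → u ∈ A) (hpend₂ : ∀ u, w s(o₂, u) ≠ 0 → u ∈ A) :
    (∀ v ∈ A, ∃ p ∈ A, (((prodBernoulli w).real {ω : BondConfig (Fin n) | (∀ x ∈ ({o₁, o₂} : Finset (Fin n)), ω ∉ openConn v x) ∧
              1 ≤ (A.filter fun z => ∃ x ∈ ({o₁, o₂} : Finset (Fin n)), ω ∈ openConn x z).card ∧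
              (A.filter fun z => ∃ x ∈ ({o₁, o₂} : Finset (Fin n)), ω ∈ openConn x z).card ≤ j} +
            (prodBernoulli w).real {ω : BondConfig (Fin n) | (∃ x ∈ ({o₁, o₂} : Finset (Fin n)), ω ∈ openConn v x) ∧
              (A.filter fun z => ω ∈ openConn v z).card ≤ j}) = 0 ∨ w s(o₁, p) ≠ 0 ∨ w s(o₂, p) ≠ 0) ∧
          ((prodBernoulli w).real {ω : BondConfig (Fin n) | (∀ x ∈ ({o₁, o₂} : Finset (Fin n)), ω ∉ openConn v x) ∧
              1 ≤ (A.filter fun z => ∃ x ∈ ({o₁, o₂} : Finset (Fin n)), ω ∈ openConn x z).card ∧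
              (A.filter fun z => ∃ x ∈ ({o₁, o₂} : Finset (Fin n)), ω ∈ openConn x z).card ≤ j} +
            (prodBernoulli w).real {ω : BondConfig (Fin n) | (∃ x ∈ ({o₁, o₂} : Finset (Fin n)), ω ∈ openConn v x) ∧
              (A.filter fun z => ω ∈ openConn v z).card ≤ j}) ≤
          (prodBernoulli w).real {ω : BondConfig (Fin n) | (A.filter fun z => ω ∈ openConn p z).card ≤ j}) :=
  dc_of_outsiderStep A o₁ o₂ j (outsiderStep_of_sharp A o₁ o₂ j hSharp) w ho₁A ho₂A h12 hw12 hpend₁ hpend₂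

end HullPort

end Summit.CriticalPhenomena.PercolationContinuityZ3.Theorems

end
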